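/-
Copyright (c) 2026 the pub-hodgecm-mathlib formalisation cell (harness21).  Prover seat hodgecm-mathlib-K2E1-p15 (g4), Track B ∕ K2-LIT, h413 = `stmt-HodgeConjecture-24833`, route `HCCMUnconditional`,
R90-TF section S8 «ContSpec-n½», (V) road ∕ ESTATE T (S8 dealer R90-CS-plan (g3), S8-R221 (3) 2026-09-05T02:19:04Z): the K-FINITE EXPORTS AT THE `K_max`-SPAN OF A τ-ADMISSIBLE WITNESS.
-/
import Summits.HodgeConjecture.HodgeConjecture.Theorems.K2E1ChiEisensteinMeromorphicExportsKFiniteOfPortsCMThree   -- ★ p864481 (this seat): `chiEisenstein_meromorphic_exports_kfinite_of_ports` (T head, both τ-ports plugged in)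
import Summits.HodgeConjecture.HodgeConjecture.Theorems.R90S8ResGMidAtomTauPureSplitU3                          -- ★ p864443 (K2E1-p12): `span_kMaxTranslates_le_chiSectionSpacePair_tauLevel`, `exists_bound_of_mem_span_kMaxTranslates`; brings ★ laws KMax p864292
                                                                                                                 --   (`finiteDimensional_span_comp_subtype_kMax_…`, `rightTranslation_mem_span_kMaxTranslates`, `mem_span_kMaxTranslates_self`), ★ β2 `continuous_of_mem_span_rightTranslation`, ★ τ-DEFS
import HarnessLib

/-!
# S8 (V) ∕ ESTATE T — `R90S8MidWitnessExportsOfTU3`: THE K-FINITE `χ`-EISENSTEIN EXPORTS AT `V := span r(K_max)φ` OF A τ-ADMISSIBLE ARCH-FINITE WITNESS `φ` — ★ OF-PORTS at the witness's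
# own `K_max`-block, every structural binder DISCHARGED from ★ laws, the archimedean left law `cB` and its restriction `χM` to `M_∞` made EXPLICIT and their letters `hVB`∕`hcBM` PROVED;
# visible: the PURITY of the block (`hVτ`, `W`-isotypy) and THE LINE (`hline`, resp. the `z`-free co-weight line `hco`)

Track B ∕ K2-LIT, crux h413 = `stmt-HodgeConjecture-24833`, route of record `HCCMUnconditional`; cell `hodgecm-mathlib`, R90-TF programme, section S8 «ContSpec-n½», (V) :358 witness road ∕
ESTATE T (rulings J-S8-T2, J-S8-T2′, J-S8-WIT′).  THEOREMS ONLY (no `def`, no `instance`, no `notation`, no named-fact hypothesis, no `sorry`; default heartbeats); lane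
`--supports stmt-HodgeConjecture-24833 --as helper` (count-neutral).  CLOSES NO SOCKET.  §1 generic quadratic datum `(F, E, c)` (rank `3`, pair currency); §2–§3 the CM print.

WHAT THIS FILE DOES ([MoeglinWaldspurger1995, I.2.17, II.1.7, IV.1.8–IV.1.11]; [BernsteinLapid2019, Thm 2.3, §4 Claim 1]; [BorelJacquet1979, §4.1–§4.2]; [Knapp1986, VII §1–§2]).  A τ-ADMISSIBLE
WITNESS is a section `φ ∈ V(χ₁, χ₂; tauLevel U₀, 1)` (`IsTauLevel U₀`, `U₀` normal in `G(𝒪̂)_f`), continuous, bounded and arch-finite — KEPT AS BINDERS (J-S8-WIT′).  Its `K_max`-block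
`V := span {r(k)φ | k ∈ K_max}` is finite-dimensional (★ `finiteDimensional_span_comp_subtype_kMax_of_mem_chiSectionSpacePair_tauLevel`), `K_max`-stable (★ `rightTranslation_mem_span_kMaxTranslates`),
made of continuous (★ `continuous_of_mem_span_rightTranslation`) bounded (★ `exists_bound_of_mem_span_kMaxTranslates`) pair-sections at the same τ-level (★
`span_kMaxTranslates_le_chiSectionSpacePair_tauLevel`), right-invariant under any GL-level `U₀′ ≤ GL₃(𝒪̂)` with `U₀′ ∩ G_f ⊆ U₀` (★ `forall_apply_mul_finAdelicToAdelic_of_le_chiSectionSpacePair`),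
and contains `φ` (★ `mem_span_kMaxTranslates_self`) — exactly the block binders of ★ `chiEisenstein_meromorphic_exports_kfinite_of_ports` (p864481), whose two archimedean letters are made
EXPLICIT and PROVED here (§1): the LEFT LAW of the flat sections along `B_∞`, `f_z^ψ(ι(b a)·ι_f x_f) = cB z b · f_z^ψ(ι(a)·ι_f x_f)` with
`cB z b := χ₁(b₀₀)·χ₂(b₁₁)·(‖b₂₂‖_𝔸⁻¹)^z` (★ `IsChiSectionPair.borel_mul`, ★ `borelHeight_borel_mul`), and `cB z = χM := χ₁(·₀₀)·χ₂(·₁₁)` on `M_∞ = B_∞ ∩ K_∞` (the modulus is `1` on `K`: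
★ `borelHeight_eq_one_of_mem`, ★ `borelHeight_one`).  So the FULL K-finite export package at `φ` (columns, scattering coordinates, continued family, ONE co-discrete pole set, (E1)–(E4),
(E2-bd) — ★ T head's conclusion byte for byte) holds MODULO TWO LETTERS of the pure-type side: the PURITY of the block `V` (`hVτ`: `V` is `W`-isotypic — spanned by its `K_∞`-equivariant
copies of a `K_∞`-type `(W, τ)`; for the shifted witness of record this is the (β) fact «the shifted arch vector lies in ONE `K_∞`-type», K2E1-p13) and THE LINE (`hline z`: the τ-embeddings
`W → I_∞(cB z)` form a line; §3: the `z`-free co-weight line `hco` for `χM` instead — the Frobenius image of ★ `R90S8KTypeSliceLineU3`'s multiplicity-one line).  NOTE: the full package is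
NOT additive across pure types (only the row shape of ★ §6 `R90S8ResGMidExportsRowAdditiveU3` is), which is why purity of THE WITNESS'S OWN block is the honest letter here.
* §1 `flatSectionU_arch_borel_mul_pair` (the explicit left law), **`hVB_of_le_chiSectionSpacePair`**, **`archBorelFactor_eq_chiM_of_mem_K`** (`hcBM`).
* §2 **`midWitness_exports_of_T`** — the export package at the witness, modulo `hVτ` + `hline`.
* §3 **`midWitness_exports_of_T_of_coweightLine`** — the same modulo `hVτ` + `hco`.
HONEST LABEL: HC_CM is proved only modulo the 7 printed citations (2 remaining named inputs: hLiu418 = `stmt-HodgeConjecture-24832`, h413 = `stmt-HodgeConjecture-24833`) until rung 0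
closes; REL ≠ ★ ≠ BUILT; hypothesis-first on purity + line, pays no socket ((V) :358 stays `sorry` in B); count-neutral.

## References
* [MoeglinWaldspurger1995] C. Mœglin, J.-L. Waldspurger, *Spectral Decomposition and Eisenstein Series* (1995), I.2.17, II.1.5–II.1.7, IV.1.8–IV.1.11.
* [BernsteinLapid2019] J. Bernstein, E. Lapid, *On the meromorphic continuation of Eisenstein series*, J. Amer. Math. Soc. 37 (2024), Thm 2.3, §4 Claim 1.
* [BorelJacquet1979] A. Borel, H. Jacquet, *Automorphic forms and automorphic representations*, Proc. Symp. Pure Math. 33.1 (1979), §1.3, §4.1–§4.2.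
* [Knapp1986] A. W. Knapp, *Representation Theory of Semisimple Groups* (1986), VII §1–§2.
* [Garrett2018] P. Garrett, *Modern Analysis of Automorphic Forms by Example* (2018), §2.2 (the `B`-law of the height).
-/

set_option autoImplicit false
set_option linter.dupNamespace false  -- the mandated namespace `…HodgeConjecture.HodgeConjecture.R90.S8` (LEAD #1 L1) repeats the summit's segment

noncomputable section

open MeasureTheory Measure Filter Topology Set NumberField IsDedekindDomain
open scoped NNReal ENNReal Classical
open Literature.MeasureTheory.Group Literature.NumberTheory Literature.NumberTheory.Automorphic Literature.NumberTheory.Automorphic.UnitaryGroup Literature.NumberTheory.GaloisRepresentations AdelicGroupData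
open Literature.NumberTheory.Automorphic.Arthur2013.Leaves.TECR Literature.NumberTheory.Rogawski1990
open Summit.HodgeConjecture.HodgeConjecture.Cruxes.H413.K2E1BorelEisensteinU
open Summit.HodgeConjecture.HodgeConjecture.Cruxes.H413.K2E1BLBorelSpacesU2Defs
open Summit.HodgeConjecture.HodgeConjecture.Cruxes.H413.K2E1BLBorelOperatorsU2Defs
open Summit.HodgeConjecture.HodgeConjecture.Cruxes.H413.K2E1CharacterEisensteinU2Defs
open Summit.HodgeConjecture.HodgeConjecture.Cruxes.H413.K2E1BLIotaClosedEmbeddingU3 (iotaBound_cm_three)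
open Summit.HodgeConjecture.HodgeConjecture.Cruxes.H413.K2E1CharacterEisensteinU3PairDefs
open Summit.HodgeConjecture.HodgeConjecture.Cruxes.H413.K2E1ChiSectionSpaceU3PairDefs
open Summit.HodgeConjecture.HodgeConjecture.Cruxes.H413.K2E1HeightFunctionU3 (borelHeight_one)
open Summit.HodgeConjecture.HodgeConjecture.Cruxes.H413.K2E1SphericalHeckeEigenSectionU2 (borelHeight_eq_one_of_mem)
open Summit.HodgeConjecture.HodgeConjecture.Cruxes.H413.K2E1ChiGaugeSymbolTauCMThree (forall_apply_mul_finAdelicToAdelic_of_le_chiSectionSpacePair)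
open Summit.HodgeConjecture.HodgeConjecture.Cruxes.H413.K2E1ChiEisensteinMeromorphicExportsKFiniteOfPortsCMThree (chiEisenstein_meromorphic_exports_kfinite_of_ports)
open Summit.HodgeConjecture.HodgeConjecture.Cruxes.H413.K2E1ChiHeckeArchScalarTauU2 (exists_line_of_coweightLine)
open Summit.HodgeConjecture.HodgeConjecture.Cruxes.H413.K2E1ChiHeckeArchScalarU2 (exists_mem_comap_borel_mul_mem_comap_K_arch)

namespace Summit.HodgeConjecture.HodgeConjecture.R90.S8

/-! ## §1 The archimedean LEFT LAW of flat pair-sections along `B_∞`, explicit; its restriction to `M_∞ = B_∞ ∩ K_∞` (generic quadratic datum `(F, E, c)`, rank `3`) -/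

section LeftLaw

variable {F E : Type} [Field F] [NumberField F] [Field E] [NumberField E] [Algebra F E] {c : E ≃ₐ[F] E}
  {χ₁ : HeckeCharacter E} {χ₂ : ↥(TorusDict.torus c) →ₜ* ℂˣ}

/-- **THE LEFT LAW OF A FLAT PAIR-SECTION ALONG `B_∞`, EXPLICIT**: for a `(χ₁, χ₂)`-pair-section `φ`, `z`, an archimedean `b` with `ι b ∈ B(𝔸)`, an archimedean `a` and a finite-adelic `x_f`,
`f_z^φ(ι(b a)·ι_f x_f) = cB z b · f_z^φ(ι(a)·ι_f x_f)` with `cB z b := χ₁(b₀₀)·χ₂(b₁₁)·(‖b₂₂‖_𝔸⁻¹)^z` (read through the `dite` on `ι b ∈ B(𝔸)`, ★ 12d-C's spelling) — ★ `IsChiSectionPair.borel_mul`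
and the `B`-law of the height ★ `borelHeight_borel_mul`. [cite: MoeglinWaldspurger1995, I.2.17, II.1.5] [cite: Garrett2018, §2.2] -/
theorem flatSectionU_arch_borel_mul_pair {φ : (quasiSplit F E c 3).Adelic → ℂ} (hφ : IsChiSectionPair χ₁ χ₂ φ) (z : ℂ)
    {b : arch F E c 3 ((StdForm.antidiagonal 3).over E)} (hb : b ∈ (borelAdelic F E c 3).comap (archToAdelic F E c 3 ((StdForm.antidiagonal 3).over E)))
    (a : arch F E c 3 ((StdForm.antidiagonal 3).over E)) (xf : finAdelic F E c 3 ((StdForm.antidiagonal 3).over E)) :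
    flatSectionU φ z (archToAdelic F E c 3 _ (b * a) * finAdelicToAdelic F E c 3 _ xf) =
      (fun b => if hb : archToAdelic F E c 3 ((StdForm.antidiagonal 3).over E) b ∈ borelAdelic F E c 3 then
          ((χ₁ (firstEntryUnit hb) : ℂˣ) : ℂ) * ((χ₂ (middleEntryUnitary hb) : ℂˣ) : ℂ) * ((((IdeleClassGroup.ideleNorm E (lastEntryUnit hb))⁻¹ : ℝ≥0) : ℝ) : ℂ) ^ z else 0) b *
        flatSectionU φ z (archToAdelic F E c 3 _ a * finAdelicToAdelic F E c 3 _ xf) := by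
  have hb' : archToAdelic F E c 3 ((StdForm.antidiagonal 3).over E) b ∈ borelAdelic F E c 3 := Subgroup.mem_comap.1 hb
  dsimp only
  rw [dif_pos hb', map_mul, mul_assoc, flatSectionU_apply, flatSectionU_apply, hφ.borel_mul hb', borelHeight_borel_mul hb', NNReal.coe_mul, Complex.ofReal_mul,
    Complex.mul_cpow_ofReal_nonneg (NNReal.coe_nonneg _) (NNReal.coe_nonneg _)]
  ring

/-- **`hVB` — THE LEFT LAW FOR EVERY MEMBER OF A SPACE OF PAIR-SECTIONS** (`V ≤ V(χ₁, χ₂; K′, ω)`): the binder `hVB` of ★ `exists_integral_pureTensor_mul_flatSectionU_eq_tau` ∕ ★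
`chiEisenstein_meromorphic_exports_kfinite_of_ports` at the explicit `cB`. [cite: MoeglinWaldspurger1995, I.2.17] [cite: Knapp1986, VII §1] -/
theorem hVB_of_le_chiSectionSpacePair {K' : Subgroup (quasiSplit F E c 3).Adelic} {ω : ↥K' → ℂ} {V : Submodule ℂ ((quasiSplit F E c 3).Adelic → ℂ)}
    (hV : V ≤ chiSectionSpacePair χ₁ χ₂ K' ω) :
    ∀ (z : ℂ), ∀ φ ∈ V, ∀ b ∈ (borelAdelic F E c 3).comap (archToAdelic F E c 3 ((StdForm.antidiagonal 3).over E)),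
      ∀ (a : arch F E c 3 ((StdForm.antidiagonal 3).over E)) (xf : finAdelic F E c 3 ((StdForm.antidiagonal 3).over E)),
        flatSectionU φ z (archToAdelic F E c 3 _ (b * a) * finAdelicToAdelic F E c 3 _ xf) =
          (fun b => if hb : archToAdelic F E c 3 ((StdForm.antidiagonal 3).over E) b ∈ borelAdelic F E c 3 then
              ((χ₁ (firstEntryUnit hb) : ℂˣ) : ℂ) * ((χ₂ (middleEntryUnitary hb) : ℂˣ) : ℂ) * ((((IdeleClassGroup.ideleNorm E (lastEntryUnit hb))⁻¹ : ℝ≥0) : ℝ) : ℂ) ^ z else 0) b *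
            flatSectionU φ z (archToAdelic F E c 3 _ a * finAdelicToAdelic F E c 3 _ xf) :=
  fun z _ hφ _ hb a xf => flatSectionU_arch_borel_mul_pair (isChiSectionPair_of_mem (hV hφ)) z hb a xf

/-- **`hcBM` — ON `M_∞ = B_∞ ∩ K_∞` THE LEFT LAW IS THE `z`-FREE CHARACTER `χM(m) := χ₁(m₀₀)·χ₂(m₁₁)`**: for `ι m ∈ B(𝔸) ∩ K` the modulus factor is `1` (`H(ι m) = ‖(ι m)₂₂‖⁻¹·H(1)`, ★
`borelHeight_borel_mul`; `H(ι m) = 1 = H(1)`, ★ `borelHeight_eq_one_of_mem`, ★ `borelHeight_one`). [cite: Garrett2018, §2.2] [cite: Knapp1986, VII §1] -/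
theorem archBorelFactor_eq_chiM_of_mem_K (z : ℂ) {m : arch F E c 3 ((StdForm.antidiagonal 3).over E)}
    (hmB : m ∈ (borelAdelic F E c 3).comap (archToAdelic F E c 3 ((StdForm.antidiagonal 3).over E)))
    (hmK : m ∈ (((standardMaximalCompactGL 3 E).comap (adelicVal F E c 3 ((StdForm.antidiagonal 3).over E))).comap (archToAdelic F E c 3 ((StdForm.antidiagonal 3).over E)))) :
    (fun b => if hb : archToAdelic F E c 3 ((StdForm.antidiagonal 3).over E) b ∈ borelAdelic F E c 3 then
        ((χ₁ (firstEntryUnit hb) : ℂˣ) : ℂ) * ((χ₂ (middleEntryUnitary hb) : ℂˣ) : ℂ) * ((((IdeleClassGroup.ideleNorm E (lastEntryUnit hb))⁻¹ : ℝ≥0) : ℝ) : ℂ) ^ z else 0) m =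
      (fun b => if hb : archToAdelic F E c 3 ((StdForm.antidiagonal 3).over E) b ∈ borelAdelic F E c 3 then
        ((χ₁ (firstEntryUnit hb) : ℂˣ) : ℂ) * ((χ₂ (middleEntryUnitary hb) : ℂˣ) : ℂ) else 0) m := by
  have hb' : archToAdelic F E c 3 ((StdForm.antidiagonal 3).over E) m ∈ borelAdelic F E c 3 := Subgroup.mem_comap.1 hmB
  have hk : adelicVal F E c 3 ((StdForm.antidiagonal 3).over E) (archToAdelic F E c 3 _ m) ∈ standardMaximalCompactGL 3 E := Subgroup.mem_comap.1 (Subgroup.mem_comap.1 hmK)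
  -- the modulus factor is `1`
  have hnorm : (IdeleClassGroup.ideleNorm E (lastEntryUnit hb'))⁻¹ = 1 := by
    have h := borelHeight_borel_mul hb' (1 : (quasiSplit F E c 3).Adelic)
    rwa [mul_one, borelHeight_eq_one_of_mem hk, borelHeight_one, mul_one, eq_comm] at h
  simp only [dif_pos hb', hnorm, NNReal.coe_one, Complex.ofReal_one, Complex.one_cpow, mul_one]

end LeftLaw

/-! ## §2 The K-finite exports at `V := span r(K_max)φ` of a τ-admissible arch-finite witness (CM print), modulo the purity of the block and the line -/

section Witness

variable (L : Type) [Field L] [NumberField L] [IsCMField L]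
  [MeasurableSpace (quasiSplit (↥(maximalRealSubfield L)) L (IsCMField.complexConj L) 3).Adelic] [BorelSpace (quasiSplit (↥(maximalRealSubfield L)) L (IsCMField.complexConj L) 3).Adelic]
  [MeasurableSpace (arch (↥(maximalRealSubfield L)) L (IsCMField.complexConj L) 3 ((StdForm.antidiagonal 3).over L))] [BorelSpace (arch (↥(maximalRealSubfield L)) L (IsCMField.complexConj L) 3 ((StdForm.antidiagonal 3).over L))]
  [MeasurableSpace (finAdelic (↥(maximalRealSubfield L)) L (IsCMField.complexConj L) 3 ((StdForm.antidiagonal 3).over L))] [BorelSpace (finAdelic (↥(maximalRealSubfield L)) L (IsCMField.complexConj L) 3 ((StdForm.antidiagonal 3).over L))]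
  (μ : Measure (quasiSplit (↥(maximalRealSubfield L)) L (IsCMField.complexConj L) 3).automorphicQuotient) [(quasiSplit (↥(maximalRealSubfield L)) L (IsCMField.complexConj L) 3).IsAutomorphicMeasure μ]
  (νG : Measure (quasiSplit (↥(maximalRealSubfield L)) L (IsCMField.complexConj L) 3).Adelic) [νG.IsHaarMeasure] [νG.IsInvInvariant] [SFinite νG]
  (ν : Measure ↥(adelicUnipotent (↥(maximalRealSubfield L)) L (IsCMField.complexConj L) 3)) [ν.IsHaarMeasure] [ν.IsMulRightInvariant] [ν.IsInvInvariant]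
  {𝓕 : Set ↥(adelicUnipotent (↥(maximalRealSubfield L)) L (IsCMField.complexConj L) 3)}
  (h𝓕N : IsFundamentalDomain ↥(rationalUnipotent (↥(maximalRealSubfield L)) L (IsCMField.complexConj L) 3) 𝓕 ν) (h𝓕c : IsCompact (closure 𝓕)) (h𝓕₀ : ν 𝓕 ≠ 0)
  {β : (quasiSplit (↥(maximalRealSubfield L)) L (IsCMField.complexConj L) 3).Adelic → ℝ≥0∞}
  (hβ : IsCoveringWeight ↥((arithmeticBorel (↥(maximalRealSubfield L)) L (IsCMField.complexConj L) 3).map (quasiSplit (↥(maximalRealSubfield L)) L (IsCMField.complexConj L) 3).arithmeticSubgroup.subtype) β)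
  {μZ : Measure (borelQuotient (↥(maximalRealSubfield L)) L (IsCMField.complexConj L) 3)} [SFinite μZ]
  (hμZ : ∀ f : borelQuotient (↥(maximalRealSubfield L)) L (IsCMField.complexConj L) 3 → ℝ≥0∞, Measurable f → ∫⁻ z, f z ∂μZ = ∫⁻ g, β g * f (toBorelQuotient (↥(maximalRealSubfield L)) L (IsCMField.complexConj L) 3 g) ∂νG)
  (μa : Measure (arch (↥(maximalRealSubfield L)) L (IsCMField.complexConj L) 3 ((StdForm.antidiagonal 3).over L))) [μa.IsHaarMeasure] [μa.IsMulRightInvariant]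
  (μf : Measure (finAdelic (↥(maximalRealSubfield L)) L (IsCMField.complexConj L) 3 ((StdForm.antidiagonal 3).over L))) [μf.IsHaarMeasure]
  -- the block characters (`χ₂` automorphic) and the τ-LEVEL `U₀` (τ-admissible, normal in `G(𝒪̂)_f`), read on `GL₃(𝔸_f)` through an open compact `U₀′ ≤ GL₃(𝒪̂)` with `U₀′ ∩ G_f ⊆ U₀`
  {χ₁ : HeckeCharacter L} {χ₂ : ↥(TorusDict.torus (IsCMField.complexConj L)) →ₜ* ℂˣ} (hχ₂ : TorusDict.IsAutomorphic (IsCMField.complexConj L) χ₂)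
  {U₀ : Subgroup ↥(finAdelic (↥(maximalRealSubfield L)) L (IsCMField.complexConj L) 3 ((StdForm.antidiagonal 3).over L))} (hU₀ : IsTauLevel L U₀)
  (hN : ∀ b ∈ (finAdelicIntegralLevel (↥(maximalRealSubfield L)) L (IsCMField.complexConj L) 3 ((StdForm.antidiagonal 3).over L)), ∀ u ∈ U₀, b * u * b⁻¹ ∈ U₀)
  (U₀' : Subgroup (GL (Fin 3) (FiniteAdeleRing (𝓞 L) L))) (hU₀'o : IsOpen (U₀' : Set (GL (Fin 3) (FiniteAdeleRing (𝓞 L) L)))) (hU₀'c : IsCompact (U₀' : Set (GL (Fin 3) (FiniteAdeleRing (𝓞 L) L))))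
  (hU₀'K : U₀' ≤ glFiniteIntegralLevel 3 L)
  (hKfU₀ : ∀ b : finAdelic (↥(maximalRealSubfield L)) L (IsCMField.complexConj L) 3 ((StdForm.antidiagonal 3).over L), (b : GL (Fin 3) (FiniteAdeleRing (𝓞 L) L)) ∈ U₀' → b ∈ U₀)
  -- THE WITNESS AS BINDERS (J-S8-WIT′): a τ-admissible, continuous, bounded, arch-finite section
  {φ : (quasiSplit (↥(maximalRealSubfield L)) L (IsCMField.complexConj L) 3).Adelic → ℂ}
  (hφ : φ ∈ chiSectionSpacePair χ₁ χ₂ (tauLevel L U₀) ((1 : ↥(tauLevel L U₀) →* ℂ) : ↥(tauLevel L U₀) → ℂ)) (hφc : Continuous φ) (hφM : ∃ M : ℝ, ∀ x, ‖φ x‖ ≤ M) (hφa : IsArchFinite L φ)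
  -- THE PURE-TYPE LETTER: the witness's `K_max`-block `span r(K_max)φ` is `W`-isotypic for a `K_∞`-type `(W, τ)`
  {W : Type*} [AddCommGroup W] [Module ℂ W] (τ : arch (↥(maximalRealSubfield L)) L (IsCMField.complexConj L) 3 ((StdForm.antidiagonal 3).over L) → W →ₗ[ℂ] W)
  (hVτ : (Submodule.span ℂ (Set.range fun k : ↥((standardMaximalCompactGL 3 L).comap (adelicVal (↥(maximalRealSubfield L)) L (IsCMField.complexConj L) 3 ((StdForm.antidiagonal 3).over L)) :
        Subgroup (quasiSplit (↥(maximalRealSubfield L)) L (IsCMField.complexConj L) 3).Adelic) =>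
      ((rightTranslation (quasiSplit (↥(maximalRealSubfield L)) L (IsCMField.complexConj L) 3)).comp ((standardMaximalCompactGL 3 L).comap (adelicVal (↥(maximalRealSubfield L)) L (IsCMField.complexConj L) 3 ((StdForm.antidiagonal 3).over L)) :
        Subgroup (quasiSplit (↥(maximalRealSubfield L)) L (IsCMField.complexConj L) 3).Adelic).subtype) k φ)) ≤
    ⨆ (J : W →ₗ[ℂ] ((quasiSplit (↥(maximalRealSubfield L)) L (IsCMField.complexConj L) 3).Adelic → ℂ)) (_ : LinearMap.range J ≤
        Submodule.span ℂ (Set.range fun k : ↥((standardMaximalCompactGL 3 L).comap (adelicVal (↥(maximalRealSubfield L)) L (IsCMField.complexConj L) 3 ((StdForm.antidiagonal 3).over L)) :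
            Subgroup (quasiSplit (↥(maximalRealSubfield L)) L (IsCMField.complexConj L) 3).Adelic) =>
          ((rightTranslation (quasiSplit (↥(maximalRealSubfield L)) L (IsCMField.complexConj L) 3)).comp ((standardMaximalCompactGL 3 L).comap (adelicVal (↥(maximalRealSubfield L)) L (IsCMField.complexConj L) 3 ((StdForm.antidiagonal 3).over L)) :
            Subgroup (quasiSplit (↥(maximalRealSubfield L)) L (IsCMField.complexConj L) 3).Adelic).subtype) k φ) ∧
      ∀ k ∈ (((standardMaximalCompactGL 3 L).comap (adelicVal (↥(maximalRealSubfield L)) L (IsCMField.complexConj L) 3 ((StdForm.antidiagonal 3).over L))).comap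
          (archToAdelic (↥(maximalRealSubfield L)) L (IsCMField.complexConj L) 3 ((StdForm.antidiagonal 3).over L))),
        ∀ (v : W) (x : (quasiSplit (↥(maximalRealSubfield L)) L (IsCMField.complexConj L) 3).Adelic), J v (x * archToAdelic (↥(maximalRealSubfield L)) L (IsCMField.complexConj L) 3 _ k) = J (τ k v) x), LinearMap.range J)

include μ h𝓕N h𝓕c h𝓕₀ hβ hμZ μa μf hχ₂ hU₀ hN hU₀'o hU₀'c hU₀'K hKfU₀ hφ hφc hφM hφa hVτ in
/-- **§2 HEAD — THE K-FINITE EXPORTS AT THE `K_max`-BLOCK OF A τ-ADMISSIBLE WITNESS, MODULO PURITY AND THE LINE**: for a τ-admissible continuous bounded arch-finite witness `φ` at a normal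
τ-level `U₀` (read on `GL₃` through `U₀′`, `U₀′ ∩ G_f ⊆ U₀`), whose `K_max`-block is `W`-isotypic (`hVτ`) and whose τ-embedding lines hold (`hline z` at the explicit left law
`cB z b = χ₁(b₀₀)χ₂(b₁₁)(‖b₂₂‖⁻¹)^z`): the conclusion of ★ `chiEisenstein_meromorphic_exports_kfinite_of_ports` AT `φ` — columns `φ'`, scattering coordinates `q`, continued family `Ec`, continued
coordinates `qc`, ONE closed co-discrete pole set `P ⊆ {Re ≤ 2}`, (E1)–(E4), (E2-bd) — every block binder discharged from ★ laws (module docstring), `hVB` by §1.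
[cite: MoeglinWaldspurger1995, I.2.17, II.1.7, IV.1.8–IV.1.11] [cite: BernsteinLapid2019, Thm 2.3, §4 Claim 1] [cite: BorelJacquet1979, §4.1–§4.2] [cite: Knapp1986, VII §1–§2] -/
theorem midWitness_exports_of_T
    (hline : ∀ z : ℂ, ∃ j₀ : W →ₗ[ℂ] (arch (↥(maximalRealSubfield L)) L (IsCMField.complexConj L) 3 ((StdForm.antidiagonal 3).over L) → ℂ),
      ∀ j : W →ₗ[ℂ] (arch (↥(maximalRealSubfield L)) L (IsCMField.complexConj L) 3 ((StdForm.antidiagonal 3).over L) → ℂ),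
        (∀ w, ∀ b ∈ (borelAdelic (↥(maximalRealSubfield L)) L (IsCMField.complexConj L) 3).comap (archToAdelic (↥(maximalRealSubfield L)) L (IsCMField.complexConj L) 3 ((StdForm.antidiagonal 3).over L)), ∀ g,
          j w (b * g) = (fun b => if hb : archToAdelic (↥(maximalRealSubfield L)) L (IsCMField.complexConj L) 3 ((StdForm.antidiagonal 3).over L) b ∈ borelAdelic (↥(maximalRealSubfield L)) L (IsCMField.complexConj L) 3 then
              ((χ₁ (firstEntryUnit hb) : ℂˣ) : ℂ) * ((χ₂ (middleEntryUnitary hb) : ℂˣ) : ℂ) * ((((IdeleClassGroup.ideleNorm L (lastEntryUnit hb))⁻¹ : ℝ≥0) : ℝ) : ℂ) ^ z else 0) b * j w g) →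
        (∀ k ∈ (((standardMaximalCompactGL 3 L).comap (adelicVal (↥(maximalRealSubfield L)) L (IsCMField.complexConj L) 3 ((StdForm.antidiagonal 3).over L))).comap
            (archToAdelic (↥(maximalRealSubfield L)) L (IsCMField.complexConj L) 3 ((StdForm.antidiagonal 3).over L))),
          ∀ (w : W) (g : arch (↥(maximalRealSubfield L)) L (IsCMField.complexConj L) 3 ((StdForm.antidiagonal 3).over L)), j w (g * k) = j (τ k w) g) → ∃ a : ℂ, j = a • j₀) :
    ∃ (n : ℕ) (φ' : Fin n → (quasiSplit (↥(maximalRealSubfield L)) L (IsCMField.complexConj L) 3).Adelic → ℂ) (q : Fin n → ℂ → ℂ) (Ec : ℂ → (quasiSplit (↥(maximalRealSubfield L)) L (IsCMField.complexConj L) 3).Adelic → ℂ) (qc : Fin n → ℂ → ℂ) (P : Set ℂ),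
      LinearIndependent ℂ φ' ∧ (∀ j, IsChiSectionPair (reflectChar (IsCMField.complexConj L) χ₁) χ₂ (φ' j)) ∧ (∀ j, Continuous (φ' j)) ∧ (∃ Mb : ℝ, ∀ j x, ‖φ' j x‖ ≤ Mb) ∧
      (∀ j, DifferentiableOn ℂ (q j) {z : ℂ | 2 < z.re}) ∧
      (∀ z : ℂ, 2 < z.re → (∑ j, q j z • φ' j) = ((((ν 𝓕).toReal⁻¹ : ℝ)) : ℂ) • (fun g : (quasiSplit (↥(maximalRealSubfield L)) L (IsCMField.complexConj L) 3).Adelic => (∫ v : ↥(adelicUnipotent (↥(maximalRealSubfield L)) L (IsCMField.complexConj L) 3), flatSectionU φ z ((quasiSplit (↥(maximalRealSubfield L)) L (IsCMField.complexConj L) 3).toAdelic (weylLongU ((IsCMField.complexConj L : L ≃ₐ[↥(maximalRealSubfield L)] L) : L →+* L) (rfl : (StdForm.antidiagonal 3).over L = (StdForm.antidiagonal 3).over L)) * ((v : (quasiSplit (↥(maximalRealSubfield L)) L (IsCMField.complexConj L) 3).Adelic) * g)) ∂ν) * (((borelHeight g : ℝ) : ℂ) ^ (z - 2)))) ∧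
      ((∀ g, MeromorphicNFOn (fun z => Ec z g) univ) ∧ (∀ j, MeromorphicNFOn (qc j) univ) ∧
      (∀ z : ℂ, 2 < z.re → Ec z = eisensteinSeriesU (flatSectionU φ z)) ∧ (∀ j (z : ℂ), 2 < z.re → qc j z = q j z) ∧
      IsClosed P ∧ (∀ z₀ : ℂ, ∀ᶠ s in 𝓝[≠] z₀, s ∉ P) ∧ (∀ z ∈ P, z.re ≤ 2) ∧
      (∀ g (z : ℂ), z ∉ P → AnalyticAt ℂ (fun z => Ec z g) z) ∧ (∀ j (z : ℂ), z ∉ P → AnalyticAt ℂ (qc j) z) ∧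
      (∀ g, DifferentiableOn ℂ (fun z => Ec z g) Pᶜ) ∧ (∀ j, DifferentiableOn ℂ (qc j) Pᶜ) ∧
      (∀ z : ℂ, z ∉ P → Continuous (Ec z)) ∧
      (∀ z₁ : ℂ, z₁ ∉ P → ∀ K : Set (quasiSplit (↥(maximalRealSubfield L)) L (IsCMField.complexConj L) 3).Adelic, IsCompact K → ∃ V ∈ 𝓝 z₁, ∃ M : ℝ, ∀ z ∈ V, ∀ g ∈ K, ‖Ec z g‖ ≤ M)) := by
  -- the witness's `K_max`-block `V := span r(K_max)φ` (in the `(r ∘ K_max.subtype) k φ` spelling of ★ laws ∕ ★ §5; the translate `r(↑k)φ` definitionally) and its ★ structural facts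
  have hSV := span_kMaxTranslates_le_chiSectionSpacePair_tauLevel L hN hφ
  haveI := finiteDimensional_span_comp_subtype_kMax_of_mem_chiSectionSpacePair_tauLevel L hU₀ hφ hφa
  have hVK : ∀ k ∈ ((standardMaximalCompactGL 3 L).comap (adelicVal (↥(maximalRealSubfield L)) L (IsCMField.complexConj L) 3 ((StdForm.antidiagonal 3).over L)) : Subgroup (quasiSplit (↥(maximalRealSubfield L)) L (IsCMField.complexConj L) 3).Adelic),
      ∀ ψ ∈ (Submodule.span ℂ (Set.range fun k : ↥((standardMaximalCompactGL 3 L).comap (adelicVal (↥(maximalRealSubfield L)) L (IsCMField.complexConj L) 3 ((StdForm.antidiagonal 3).over L)) :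
          Subgroup (quasiSplit (↥(maximalRealSubfield L)) L (IsCMField.complexConj L) 3).Adelic) =>
        ((rightTranslation (quasiSplit (↥(maximalRealSubfield L)) L (IsCMField.complexConj L) 3)).comp ((standardMaximalCompactGL 3 L).comap (adelicVal (↥(maximalRealSubfield L)) L (IsCMField.complexConj L) 3 ((StdForm.antidiagonal 3).over L)) :
          Subgroup (quasiSplit (↥(maximalRealSubfield L)) L (IsCMField.complexConj L) 3).Adelic).subtype) k φ)),
      (fun x => ψ (x * k)) ∈ (Submodule.span ℂ (Set.range fun k : ↥((standardMaximalCompactGL 3 L).comap (adelicVal (↥(maximalRealSubfield L)) L (IsCMField.complexConj L) 3 ((StdForm.antidiagonal 3).over L)) :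
          Subgroup (quasiSplit (↥(maximalRealSubfield L)) L (IsCMField.complexConj L) 3).Adelic) =>
        ((rightTranslation (quasiSplit (↥(maximalRealSubfield L)) L (IsCMField.complexConj L) 3)).comp ((standardMaximalCompactGL 3 L).comap (adelicVal (↥(maximalRealSubfield L)) L (IsCMField.complexConj L) 3 ((StdForm.antidiagonal 3).over L)) :
          Subgroup (quasiSplit (↥(maximalRealSubfield L)) L (IsCMField.complexConj L) 3).Adelic).subtype) k φ)) :=
    fun k hk ψ hψ => rightTranslation_mem_span_kMaxTranslates L φ ⟨k, hk⟩ hψ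
  exact chiEisenstein_meromorphic_exports_kfinite_of_ports L μ νG ν h𝓕N h𝓕c h𝓕₀ hβ hμZ μa μf hχ₂ _ hVK (fun ψ hψ => isChiSectionPair_of_mem (hSV hψ))
    (fun ψ hψ => continuous_of_mem_span_rightTranslation L hφc hψ) (fun ψ hψ => exists_bound_of_mem_span_kMaxTranslates L hφM hψ) U₀' hU₀'o hU₀'c hU₀'K
    (forall_apply_mul_finAdelicToAdelic_of_le_chiSectionSpacePair U₀' (fun b hb => ⟨finAdelicToAdelic_mem_tauLevel L (hKfU₀ b hb), MonoidHom.one_apply _⟩) hSV)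
    τ _ (hVB_of_le_chiSectionSpacePair hSV) hVτ hline (mem_span_kMaxTranslates_self L φ)

/-! ## §3 The same from the `z`-free co-weight line for `χM = χ₁(·₀₀)·χ₂(·₁₁)` on `M_∞` (Frobenius ★ `exists_line_of_coweightLine`, CM arch Iwasawa; `hcBM` by §1) -/

include μ h𝓕N h𝓕c h𝓕₀ hβ hμZ μa μf hχ₂ hU₀ hN hU₀'o hU₀'c hU₀'K hKfU₀ hφ hφc hφM hφa hVτ in
/-- **§3 HEAD — THE SAME PACKAGE FROM THE CO-WEIGHT LINE**: as `midWitness_exports_of_T`, with `hline` replaced by the `z`-FREE co-weight line `hco` «the linear `λ : W → ℂ` with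
`λ(τ(m)w) = χ₁(m₀₀)χ₂(m₁₁)·λ(w)` (`m ∈ M_∞ = B_∞ ∩ K_∞`) form a line» — the Frobenius image of ★ `R90S8KTypeSliceLineU3`'s multiplicity-one line; `hcBM` is §1's
`archBorelFactor_eq_chiM_of_mem_K`, the arch Iwasawa is the CM one (`c ≠ 1` ★ `IsCMField.complexConj_ne_one`, ★ `complexConj_smul_infinitePlace`).
[cite: Knapp1986, VII §1–§2] [cite: MoeglinWaldspurger1995, I.2.17, IV.1.8–IV.1.11] [cite: BernsteinLapid2019, Thm 2.3, §4 Claim 1] -/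
theorem midWitness_exports_of_T_of_coweightLine
    (hco : ∃ l₀ : W →ₗ[ℂ] ℂ, ∀ l : W →ₗ[ℂ] ℂ,
      (∀ m ∈ (borelAdelic (↥(maximalRealSubfield L)) L (IsCMField.complexConj L) 3).comap (archToAdelic (↥(maximalRealSubfield L)) L (IsCMField.complexConj L) 3 ((StdForm.antidiagonal 3).over L)),
        m ∈ (((standardMaximalCompactGL 3 L).comap (adelicVal (↥(maximalRealSubfield L)) L (IsCMField.complexConj L) 3 ((StdForm.antidiagonal 3).over L))).comap
          (archToAdelic (↥(maximalRealSubfield L)) L (IsCMField.complexConj L) 3 ((StdForm.antidiagonal 3).over L))) →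
        ∀ w, l (τ m w) = (fun b => if hb : archToAdelic (↥(maximalRealSubfield L)) L (IsCMField.complexConj L) 3 ((StdForm.antidiagonal 3).over L) b ∈ borelAdelic (↥(maximalRealSubfield L)) L (IsCMField.complexConj L) 3 then
            ((χ₁ (firstEntryUnit hb) : ℂˣ) : ℂ) * ((χ₂ (middleEntryUnitary hb) : ℂˣ) : ℂ) else 0) m * l w) → ∃ a : ℂ, l = a • l₀) :
    ∃ (n : ℕ) (φ' : Fin n → (quasiSplit (↥(maximalRealSubfield L)) L (IsCMField.complexConj L) 3).Adelic → ℂ) (q : Fin n → ℂ → ℂ) (Ec : ℂ → (quasiSplit (↥(maximalRealSubfield L)) L (IsCMField.complexConj L) 3).Adelic → ℂ) (qc : Fin n → ℂ → ℂ) (P : Set ℂ),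
      LinearIndependent ℂ φ' ∧ (∀ j, IsChiSectionPair (reflectChar (IsCMField.complexConj L) χ₁) χ₂ (φ' j)) ∧ (∀ j, Continuous (φ' j)) ∧ (∃ Mb : ℝ, ∀ j x, ‖φ' j x‖ ≤ Mb) ∧
      (∀ j, DifferentiableOn ℂ (q j) {z : ℂ | 2 < z.re}) ∧
      (∀ z : ℂ, 2 < z.re → (∑ j, q j z • φ' j) = ((((ν 𝓕).toReal⁻¹ : ℝ)) : ℂ) • (fun g : (quasiSplit (↥(maximalRealSubfield L)) L (IsCMField.complexConj L) 3).Adelic => (∫ v : ↥(adelicUnipotent (↥(maximalRealSubfield L)) L (IsCMField.complexConj L) 3), flatSectionU φ z ((quasiSplit (↥(maximalRealSubfield L)) L (IsCMField.complexConj L) 3).toAdelic (weylLongU ((IsCMField.complexConj L : L ≃ₐ[↥(maximalRealSubfield L)] L) : L →+* L) (rfl : (StdForm.antidiagonal 3).over L = (StdForm.antidiagonal 3).over L)) * ((v : (quasiSplit (↥(maximalRealSubfield L)) L (IsCMField.complexConj L) 3).Adelic) * g)) ∂ν) * (((borelHeight g : ℝ) : ℂ) ^ (z - 2)))) ∧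
      ((∀ g, MeromorphicNFOn (fun z => Ec z g) univ) ∧ (∀ j, MeromorphicNFOn (qc j) univ) ∧
      (∀ z : ℂ, 2 < z.re → Ec z = eisensteinSeriesU (flatSectionU φ z)) ∧ (∀ j (z : ℂ), 2 < z.re → qc j z = q j z) ∧
      IsClosed P ∧ (∀ z₀ : ℂ, ∀ᶠ s in 𝓝[≠] z₀, s ∉ P) ∧ (∀ z ∈ P, z.re ≤ 2) ∧
      (∀ g (z : ℂ), z ∉ P → AnalyticAt ℂ (fun z => Ec z g) z) ∧ (∀ j (z : ℂ), z ∉ P → AnalyticAt ℂ (qc j) z) ∧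
      (∀ g, DifferentiableOn ℂ (fun z => Ec z g) Pᶜ) ∧ (∀ j, DifferentiableOn ℂ (qc j) Pᶜ) ∧
      (∀ z : ℂ, z ∉ P → Continuous (Ec z)) ∧
      (∀ z₁ : ℂ, z₁ ∉ P → ∀ K : Set (quasiSplit (↥(maximalRealSubfield L)) L (IsCMField.complexConj L) 3).Adelic, IsCompact K → ∃ V ∈ 𝓝 z₁, ∃ M : ℝ, ∀ z ∈ V, ∀ g ∈ K, ‖Ec z g‖ ≤ M)) := by
  refine midWitness_exports_of_T L μ νG ν h𝓕N h𝓕c h𝓕₀ hβ hμZ μa μf hχ₂ hU₀ hN U₀' hU₀'o hU₀'c hU₀'K hKfU₀ hφ hφc hφM hφa τ hVτ fun z => ?_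
  obtain ⟨l₀, hl₀⟩ := hco
  exact exists_line_of_coweightLine _ _ _ τ
    (exists_mem_comap_borel_mul_mem_comap_K_arch (IsCMField.complexConj_ne_one L) (complexConj_smul_infinitePlace L))
    ⟨l₀, fun l hl => hl₀ l fun m hmB hmK w => by rw [← archBorelFactor_eq_chiM_of_mem_K z hmB hmK]; exact hl m hmB hmK w⟩

end Witness

end Summit.HodgeConjecture.HodgeConjecture.R90.S8

end
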